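import Summits.QuantumFields.BalabanUV.Beta.D1BFx.MomentTransferKronecker

/-!
# `BalabanUV.Beta.D1BFx.MomentTransferKroneckerWard` — roads «BF-x» / «FP» for binder row D1, leaf K-R5 REFINED (part 2, §5): THE DIAGONAL
# BASE-POINT FIRST MOMENTS OF A FIRST-BOND DIVERGENCE-FREE TWO-POINT FAMILY VANISH (the `tsum` Ward identity for the QUADRATIC gauge
# function, by telescoping), and the `d = 4` END `coarse bond second moment = base-point average` at the entries `κ, λ ∈ {a, b}` FROM WARD DATA
# ONLY — no reflection / inversion covariance, no `hT1`

HONEST DEPENDENCY (page 1, mandatory): continuum YM on T⁴ ⇐ BetaPertH ∧ nine spine estimates (0/9 proved); BetaPertH ⇐ (D1) ∧ (D4) ∧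
CAP+tail; G-an2-4 gates asym, D1 and NE2/3/4.  HONEST FRAMING (cell contract, verbatim): «discharging `BetaPertH` makes Bałaban's UV
stability UNCONDITIONAL — a real constructive-QFT result; it is NOT the continuum limit and NOT the Clay problem.»  THIS MODULE DISCHARGES
NOTHING of D1 / BetaPertH: [folklore] bookkeeping of absolutely convergent lattice sums over `ℝ` — an2's telescoping
(`KernelRepresentationSummable.hasSum_zero_of_divFree`, `hasSum_first_shift`) one degree up, and part 1's `bondSecondMomentP_tsum_four_of_diag`
BY NAME.  No `def`, no `Prop` mirror, no cited fact, 0 sorry; every hypothesis DISPLAYED; 0 wall binders; NOT hrep, NOT D1, NOT BetaPertH, NOT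
continuum, NOT Clay.

ABSOLUTE RULE (cell charter, verbatim): «No internally-minted statement may enter as a cited fact. Every hypothesis is either
kernel-proved in this package or a verbatim quotation of a PUBLISHED theorem with page reference. The manuscript(s) under audit are NOT
citable for their own disputed steps — they are the thing under adjudication; programme-internal (2001/route/tribunal) claims are never
citable.»

WHY.  Part 1 (`MomentTransferKronecker`) trades K-R5's `hT1` — ALL base-point-summed first moments of every entry — for its DIAGONAL part
`∀ c e, Σ_{classes r} Σ'_t t_c · P c e (r+t) r = 0` (plus transposition symmetry and Kronecker first moments of the column).  The diagonal part is
a WARD IDENTITY: pairing first-bond divergence-freeness `Σ_μ (K_{μν}(x) − K_{μν}(x − e_μ)) = 0` with the weight `x_c²` and telescoping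
(`(x+e_μ)_c² − x_c² = δ_{cμ}(2x_c + 1)`) gives `2·Σ_x x_c K_{cν}(x) + Σ_x K_{cν}(x) = 0`, and the zeroth moment vanishes by the same pairing with
`x_c` (an2's `hasSum_zero_of_divFree`) — i.e. gauge invariance under the quadratic gauge function `λ = x_c(x_c−1)/2`, whose gradient is the
1-form `x_c e_c`.  First-bond divergence-freeness is EXACTLY the input from which leaf-01's `FineHessianWard.divFree_fineHessA_of_wardLaws` /
`hasSum_col_of_divFree` already produce the Ward rows `hrow` ((W1)/(W2), an2's `KernelWard.ward_hess`): no new physical hypothesis enters.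
Off its own direction the first moment of a divergence-free family is NOT constrained (the `(d choose 3)` ε-pseudo-scalars of `hT1` located by
beta-num-g37, CLAIMS 2026-08-20T14:08:28Z) — and part 1 shows they are never consumed at the entries `κ, λ ∈ {a, b}`.

CONTENT (all [folklore], `d`, `N` general unless stated): `hasSum_sq_shift`; **`hasSum_diagFirstMoment_of_divFree`**;
`hasSum_diagFirstMoment_baseKer_of_divFree`, `sum_diagFirstMoment_baseKer_eq_zero_of_divFree` (part 1's `hT1d`, pointwise in the base point);
`hasSum_col_of_divFree'` (generic-`d` spelling of `FineHessianWard.hasSum_col_of_divFree`); the END **`bondSecondMomentP_tsum_four_of_divFree`**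
(`d = 4`, `κ, λ ∈ {a, b}`).  Unit `b2b-balaban-beta-d1-formalise-leaf-02` (gen 4).
-/

namespace Summit.QuantumFields.BalabanUV.Beta.D1BFx.MomentTransferKroneckerWard

open Finset Filter Topology
open Literature.MathematicalPhysics.QuantumFieldTheory.Balaban1983to89
open Literature.MathematicalPhysics.QuantumFieldTheory.Balaban1983to89.Beta
open DecimatedMoment (cosetInd)
open DecimatedMomentSummable (IsMoment₂ ConstReproSum LinReproSum AbsMoment₂ summable_of_absMoment₂ summable_smul_of_absMoment₂)
open DressedMomentNormalisation (EKer resSite)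
open KernelRepresentationSummable (hasSum_zero_of_divFree)
open MomentTransferPeriodic MomentTransferPeriodicSum
open MomentTransferPeriodicEntry (EKer₂ dressedEntryP avgM2)
open MomentTransferKronecker (bondSecondMomentP_tsum_four_of_diag)

variable {d N : ℕ}

/-! ## §5 The diagonal first moments from first-bond divergence-freeness (the quadratic-gauge Ward identity) -/

/-- [folklore] Shift reindexing of a second-moment family in ONE coordinate: `Σ' (y_c y_c) • f (y − e)` has the sum
`Q + (2 e_c) • A + (e_c e_c) • B` when `Σ' (y_c y_c) • f = Q`, `Σ' y_c • f = A`, `Σ' f = B` (`Equiv.addRight e`; the first-moment analogue is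
an2's `KernelRepresentationSummable.hasSum_first_shift`). -/
theorem hasSum_sq_shift {f : (Fin d → ℤ) → ℝ} {Q A B : ℝ} (c : Fin d) (e : Fin d → ℤ)
    (h2 : HasSum (fun y : Fin d → ℤ => (y c * y c) • f y) Q) (h1 : HasSum (fun y : Fin d → ℤ => y c • f y) A)
    (h0 : HasSum f B) :
    HasSum (fun y : Fin d → ℤ => (y c * y c) • f (y - e)) (Q + (2 * e c) • A + (e c * e c) • B) := by
  refine (Equiv.hasSum_iff (Equiv.addRight e) (f := fun y : Fin d → ℤ => (y c * y c) • f (y - e))).1 ?_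
  refine ((h2.add (h1.const_smul (2 * e c))).add (h0.const_smul (e c * e c))).congr_fun fun y => ?_
  simp only [Function.comp_apply, Equiv.coe_addRight, Pi.add_apply, add_sub_cancel_right, smul_smul]
  rw [← add_smul, ← add_smul]
  congr 1
  ring

/-- [folklore] **THE QUADRATIC-GAUGE WARD IDENTITY (`tsum` form): THE DIAGONAL FIRST MOMENT OF A FIRST-INDEX DIVERGENCE-FREE FAMILY VANISHES.**
For a matrix family `K μ ν : ℤ^d → ℝ` of entries with absolutely summable second moments, divergence-free in the first index (backward
differences: `Σ_μ (K_{μν}(x) − K_{μν}(x − e_μ)) = 0` for all `x`), the first moment IN ITS OWN DIRECTION of every entry vanishes: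
`Σ_y y_c · K c ν y = 0` — pair the divergence identity with the weight `y_c²` and telescope (`(y+e_μ)_c² − y_c² = δ_{cμ}(2y_c + 1)`),
then use the zeroth moment `Σ_y K c ν y = 0` (an2's `hasSum_zero_of_divFree`, the same pairing with `y_c`).  Off its own direction the first
moment of a divergence-free family is NOT constrained. -/
theorem hasSum_diagFirstMoment_of_divFree (K : Fin d → Fin d → (Fin d → ℤ) → ℝ) (hK : ∀ μ ν, AbsMoment₂ (K μ ν))
    (hdiv : ∀ ν x, ∑ μ, (K μ ν x - K μ ν (x - Pi.single μ 1)) = 0) (c ν : Fin d) :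
    HasSum (fun y : Fin d → ℤ => (y c : ℝ) * K c ν y) 0 := by
  have hA : ∀ μ, HasSum (fun y : Fin d → ℤ => y c • K μ ν y) (∑' y : Fin d → ℤ, y c • K μ ν y) := fun μ =>
    (summable_smul_of_absMoment₂ (hK μ ν) (IsMoment₂.coord c)).hasSum
  have hQ : ∀ μ, HasSum (fun y : Fin d → ℤ => (y c * y c) • K μ ν y) (∑' y : Fin d → ℤ, (y c * y c) • K μ ν y) := fun μ =>
    (summable_smul_of_absMoment₂ (hK μ ν) (IsMoment₂.coord2 c c)).hasSum
  have hB : ∀ μ, HasSum (K μ ν) (∑' y, K μ ν y) := fun μ => (summable_of_absMoment₂ (hK μ ν)).hasSum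
  have hS := hasSum_sum (s := (Finset.univ : Finset (Fin d)))
    (fun μ _ => (hQ μ).sub (hasSum_sq_shift c (Pi.single μ 1) (hQ μ) (hA μ) (hB μ)))
  have hZ : HasSum (fun y : Fin d → ℤ =>
      ∑ μ ∈ (Finset.univ : Finset (Fin d)), ((y c * y c) • K μ ν y - (y c * y c) • K μ ν (y - Pi.single μ 1))) 0 := by
    have h0 : (fun y : Fin d → ℤ =>
        ∑ μ ∈ (Finset.univ : Finset (Fin d)), ((y c * y c) • K μ ν y - (y c * y c) • K μ ν (y - Pi.single μ 1)))
        = fun _ => 0 := by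
      funext y
      simp only [← smul_sub, ← Finset.smul_sum, hdiv ν y, smul_zero]
    rw [h0]
    exact hasSum_zero
  have e := hS.unique hZ
  -- `e : Σ_μ (Q μ − (Q μ + (2 e_μ c) • A μ + (e_μ c)² • B μ)) = 0`, i.e. `2 • A c + B c = 0`
  have e' : ∀ μ : Fin d, (∑' y : Fin d → ℤ, (y c * y c) • K μ ν y)
      - ((∑' y : Fin d → ℤ, (y c * y c) • K μ ν y) + (2 * (Pi.single μ (1 : ℤ) : Fin d → ℤ) c) • (∑' y : Fin d → ℤ, y c • K μ ν y)
        + ((Pi.single μ (1 : ℤ) : Fin d → ℤ) c * (Pi.single μ (1 : ℤ) : Fin d → ℤ) c) • ∑' y, K μ ν y)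
      = if μ = c then -((2 : ℤ) • (∑' y : Fin d → ℤ, y c • K c ν y) + ∑' y, K c ν y) else 0 := by
    intro μ
    by_cases hμ : μ = c
    · subst hμ
      simp only [Pi.single_eq_same, mul_one, one_smul, if_true]
      abel
    · have hc : (Pi.single μ (1 : ℤ) : Fin d → ℤ) c = 0 := by
        rw [Pi.single_apply, if_neg (Ne.symm hμ)]
      simp only [hc, mul_zero, zero_smul, add_zero, sub_self, if_neg hμ]
  simp only [e', Finset.sum_ite_eq', Finset.mem_univ, if_true, neg_eq_zero] at e
  have hB0 : ∑' y, K c ν y = 0 := (hasSum_zero_of_divFree K hK hdiv c ν).tsum_eq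
  rw [hB0, add_zero, smul_eq_zero] at e
  have hA0 : ∑' y : Fin d → ℤ, y c • K c ν y = 0 := e.resolve_left (by norm_num)
  have h := hA c
  rw [hA0] at h
  refine h.congr_fun (fun y => ?_)
  rw [zsmul_eq_mul]

/-- [folklore] **THE DIAGONAL FIRST MOMENT OF EVERY BASE-POINT KERNEL VANISHES FOR A FIRST-BOND DIVERGENCE-FREE TWO-POINT FAMILY**, pointwise in the
base point: `P c e : ℤ^d → ℤ^d → ℝ` with `Σ_c (P c e (u − e_c) u' − P c e u u') = 0` and absolutely summable base-point kernels ⟹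
`Σ_t t_c · P c e (b+t) b = 0` for every `c, e, b` (§5's Ward identity on `t ↦ P μ e (b+t) b`, re-indexed as in
`FineHessianWard.hasSum_col_of_divFree`). -/
theorem hasSum_diagFirstMoment_baseKer_of_divFree {P : EKer₂ d}
    (hdiv : ∀ (e : Fin d) (u' u : Fin d → ℤ), ∑ c, (P c e (u - Pi.single c 1) u' - P c e u u') = 0)
    (hPA : ∀ c e b, AbsMoment₂ (baseKer (P c e) b)) (c e : Fin d) (b : Fin d → ℤ) :
    HasSum (fun t : Fin d → ℤ => (t c : ℝ) * baseKer (P c e) b t) 0 := by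
  have hdiv' : ∀ (ν : Fin d) (t : Fin d → ℤ),
      ∑ μ, (baseKer (P μ ν) b t - baseKer (P μ ν) b (t - Pi.single μ 1)) = 0 := by
    intro ν t
    have h := hdiv ν b (b + t)
    rw [← neg_eq_zero, ← Finset.sum_neg_distrib] at h
    rw [← h]
    refine Finset.sum_congr rfl fun μ _ => ?_
    rw [neg_sub, baseKer, baseKer, add_sub_assoc]
  exact hasSum_diagFirstMoment_of_divFree (fun μ ν => baseKer (P μ ν) b) (fun μ ν => hPA μ ν b) hdiv' c e

/-- [folklore] … hence the DIAGONAL base-point-summed first moments vanish — the hypothesis `hT1d` of §4. -/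
theorem sum_diagFirstMoment_baseKer_eq_zero_of_divFree {P : EKer₂ d}
    (hdiv : ∀ (e : Fin d) (u' u : Fin d → ℤ), ∑ c, (P c e (u - Pi.single c 1) u' - P c e u u') = 0)
    (hPA : ∀ c e b, AbsMoment₂ (baseKer (P c e) b)) (c e : Fin d) :
    ∑ r : Fin d → Fin N, ∑' t, (t c : ℝ) * baseKer (P c e) (resSite r) t = 0 :=
  Finset.sum_eq_zero fun r _ => (hasSum_diagFirstMoment_baseKer_of_divFree hdiv hPA c e (resSite r)).tsum_eq

/-- [folklore] Columns of a first-bond divergence-free family vanish (generic `d`; an2's `hasSum_zero_of_divFree` on the base-point kernels —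
`FineHessianWard.hasSum_col_of_divFree` is the `d = 4` / `unitVec` spelling). -/
theorem hasSum_col_of_divFree' {P : EKer₂ d}
    (hdiv : ∀ (e : Fin d) (u' u : Fin d → ℤ), ∑ c, (P c e (u - Pi.single c 1) u' - P c e u u') = 0)
    (hPA : ∀ c e b, AbsMoment₂ (baseKer (P c e) b)) (c e : Fin d) (b : Fin d → ℤ) :
    HasSum (fun s => P c e s b) 0 := by
  have hdiv' : ∀ (ν : Fin d) (t : Fin d → ℤ),
      ∑ μ, (baseKer (P μ ν) b t - baseKer (P μ ν) b (t - Pi.single μ 1)) = 0 := by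
    intro ν t
    have h := hdiv ν b (b + t)
    rw [← neg_eq_zero, ← Finset.sum_neg_distrib] at h
    rw [← h]
    refine Finset.sum_congr rfl fun μ _ => ?_
    rw [neg_sub, baseKer, baseKer, add_sub_assoc]
  have h0 := hasSum_zero_of_divFree (fun μ ν => baseKer (P μ ν) b) (fun μ ν => hPA μ ν b) hdiv' c e
  exact (Equiv.hasSum_iff (Equiv.addLeft b) (f := fun s => P c e s b)).mp (h0.congr_fun fun _ => rfl)

/-- [folklore] **THE END OF THIS MODULE — `d = 4`, ENTRIES `κ, λ ∈ {a, b}`, FROM WARD DATA ONLY.**  A transposition-symmetric block-periodic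
family `P` with absolutely summable base-point kernels which is DIVERGENCE-FREE IN THE FIRST BOND (hence — by symmetry — has rows and
columns summing to zero and vanishing diagonal first moments), dressed by a column with Kronecker masses and Kronecker first moments:
`Σ'_z z_κ z_λ · N⁸ · dressedEntryP w P (N•z) a b = avgM2 N (P a b) κ λ` for `κ, λ ∈ {a, b}` — NO reflection / inversion covariance, NO `hT1`. -/
theorem bondSecondMomentP_tsum_four_of_divFree (hN : 0 < N) (w : EKer 4) (P : EKer₂ 4)
    (hP : ∀ c e, IsBlockPeriodic N (P c e)) (hsymm : ∀ c e s s', P c e s s' = P e c s' s)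
    (hdiv : ∀ (e : Fin 4) (u' u : Fin 4 → ℤ), ∑ c, (P c e (u - Pi.single c 1) u' - P c e u u') = 0)
    (hw0 : ∀ κ l, ConstReproSum N (w κ l) (if κ = l then (((N : ℝ) ^ (4 + 1))⁻¹) else 0))
    {C1 : Fin 4 → Fin 4 → ℝ} (hw1 : ∀ κ l, LinReproSum N (w κ l) (fun μ => if κ = l then C1 κ μ else 0))
    (hwA : ∀ κ l, AbsMoment₂ (w κ l)) (hPA : ∀ c e b, AbsMoment₂ (baseKer (P c e) b))
    {κ lam a b : Fin 4} (hκ : κ = a ∨ κ = b) (hlam : lam = a ∨ lam = b) :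
    ∑' z : Fin 4 → ℤ, ((z κ * z lam : ℤ) : ℝ) * ((N : ℝ) ^ 8 * dressedEntryP w P ((N : ℤ) • z) a b)
      = avgM2 N (P a b) κ lam := by
  have hcol : ∀ c e b, HasSum (fun s => P c e s b) 0 := hasSum_col_of_divFree' hdiv hPA
  have hrow : ∀ c e b, HasSum (P c e b) 0 := fun c e b' => (hcol e c b').congr_fun (fun s => hsymm c e b' s)
  exact bondSecondMomentP_tsum_four_of_diag hN w P hP hsymm hw0 hw1 hwA hPA hrow
    (sum_diagFirstMoment_baseKer_eq_zero_of_divFree hdiv hPA) hκ hlam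

end Summit.QuantumFields.BalabanUV.Beta.D1BFx.MomentTransferKroneckerWard
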